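import Mathlib
import Summits.KontsevichZagierPeriods.Zeta5Search.T1RayKit
import HarnessLib

/-!
# ζ(5) search — RAY #1 of the T1 map (`β = (85; 35,32,30,27,25,22,20)`, `d = 64`): its top type-space windows, typed (HONEST FRAMING: systematic search; no irrationality claim unless certified)

Cell `pub-zeta5`, GEN-2 seat generation 16.  Census g22's T1 map (`xsave/g22/t1map/t1map.md`, row "g8 #1 by γ′") ranks the ray of g8 class #1
(`a = (18,32,23,30,28,38,43,30)`, `β = (85; 35,32,30,27,25,22,20)`, `d = 64`) as the direction with the largest margin past `λ*` in the by-guard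
column (MODEL value; uncertified); task C26.0 asks for its type-space windows as TREE STATEMENTS.  The ray is not an arithmetic progression, so it
is the general ray `bRay β1 n` of `T1RayKit`.  gen-2 g16 `t1rays/thetaprofile.py` + `wclass.py` (LITERAL evaluation of the tree predicates at every
window prime with `n ≤ 200`, 0 failures; see REPORT-gen2-g16 §6) find the UNIVERSAL `M = 8` pair of top windows and two deeper zero windows:

* ZERO window `θ = p/n ∈ (20, 21]`, `M = 8`: deep palindrome `ZeroWindows.D8 = [[1,-5,-5,1]]`, extra pair `T1Rays.Sz8 = [[1,-6,-3,1]]` (2 560 instances;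
  the window is exact: on `(21, 64/3]` the pole order is 7 and neither regime applies);
* ORIGIN window `θ ∈ (19, 20]`, `M = 8`: the ray-#4 lists `Ray4Windows.D8 / S8` on the line `u8 = (33,−49)`, `c8 = −174`, plus the odd-centre type
  `T1Rays.Pc8` for odd `n` (`b₀ = 85n`); line data PROVED (`T1Rays.lineData8c`) (2 574 instances);
* ZERO window `θ ∈ (38/3, 64/5]`, `M = 12`: the SAME lists `Dz12 / Sz12` as ray #5's `(23/3, 39/5]` (359 instances);
* ZERO window `θ ∈ (163/21, 8]`, `M = 18` (the validated extent; just below it the profile alternates with an `M = 17` origin layer, not typed):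
  deep palindrome `Dz18` as on ray #5 but a DIFFERENT extra pair `S18r1` (691 instances);

(between them: `(18, 19)` has no type-space regime at `M = 8`, `(17.53, 17.97)` is an `M = 9` origin layer with varying pair lists — not typed), each as an
`@[conjecture]` class-structure node with the PROVED reduction to the window bound, kernel instances by `decide` at the first window primes, and
the resulting UNCONDITIONAL valuation bounds there.  `p`-adic bookkeeping of rational numbers; nothing here bears on irrationality.
-/

noncomputable section

open Finset

namespace Summit.KontsevichZagierPeriods.Zeta5Search.T1Rays

open Summit.KontsevichZagierPeriods.Zeta5Search.CasoratianValuation (InPolytope shift casoratian)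
open Summit.KontsevichZagierPeriods.Zeta5Search.ClusterValuation
open Summit.KontsevichZagierPeriods.Zeta5Search.SecondOrder
open Summit.KontsevichZagierPeriods.Zeta5Search.ResidueLaw
open Summit.KontsevichZagierPeriods.Zeta5Search.WedgeDictionary (dOf)
open Summit.KontsevichZagierPeriods.Zeta5Search.ZeroWindows (ZeroWindowClasses)
open Summit.KontsevichZagierPeriods.Zeta5Search.OriginWindows (OriginWindowClasses LineData)

/-! ## §1 The ray and its four facts -/

/-- Direction #1 of the T1 map (g8 class #1): `β = (85; 35, 32, 30, 27, 25, 22, 20)`, `d = 3·85 − 191 = 64`. -/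
def β1 : List ℤ := [85, 35, 32, 30, 27, 25, 22, 20]

/-- `b₀ = 85n`. -/
theorem ray1_zero (n : ℕ) : bRay β1 n 0 = ((85 * n : ℕ) : ℤ) := by
  simp [bRay, β1, mul_comm]

/-- The ray lies in the polytope. -/
theorem inPolytope_ray1 (n : ℕ) : InPolytope (bRay β1 n) := by
  refine ⟨⟨?_, ?_⟩, ?_, ?_⟩
  · simp [bRay, β1]
  · intro j hj
    simp only [Finset.mem_range] at hj
    interval_cases j <;> simp [bRay, β1] <;> omega
  · intro i hi
    simp only [Finset.mem_range] at hi
    interval_cases i <;> simp [bRay, β1] <;> omega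
  · simp [bRay, β1, Finset.sum_range_succ]; omega

/-- Its `e₇`-shift lies in the polytope (`n ≥ 1`). -/
theorem inPolytope_shift_ray1 {n : ℕ} (hn : 1 ≤ n) : InPolytope (shift (bRay β1 n) 7) := by
  refine ⟨⟨?_, ?_⟩, ?_, ?_⟩
  · simp [shift, bRay, β1]
  · intro i hi
    simp only [Finset.mem_range] at hi
    interval_cases i <;> simp [shift, bRay, β1, Function.update] <;> omega
  · intro i hi
    simp only [Finset.mem_range] at hi
    interval_cases i <;> simp [shift, bRay, β1, Function.update] <;> omega
  · simp [shift, bRay, β1, Function.update, Finset.sum_range_succ]; omega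

/-- `d = 64n` on ray #1. -/
theorem dOf_ray1 (n : ℕ) : dOf (bRay β1 n) = 64 * (n : ℤ) := by
  simp [dOf, bRay, β1, Finset.sum_range_succ]; ring

/-- The ZERO-regime reduction on ray #1 (`b₀ = 85n`, DEG `p(M − 2) ≤ 128n + 1`). -/
theorem ray1Zero_of_classes (n p M : ℕ) (D S : List (List ℤ)) (hn : 1 ≤ n) (hp : p.Prime) (h5 : 5 ≤ p) (hpn : p ≤ 85 * n)
    (hp2 : 85 * n + 2 < p ^ 2) (hM : 6 ≤ M) (hMe : Even M) (hdeg : (p : ℤ) * ((M : ℤ) - 2) ≤ 128 * n + 1)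
    (hD : ∀ T ∈ D, T.reverse = T) (hlen : D.length + S.length ≤ 2) (hC : ZeroWindowClasses (bRay β1 n) p M D S)
    (hne : casoratian (bRay β1 n) 7 ≠ 0) : (6 : ℤ) - 2 * M ≤ padicValRat p (casoratian (bRay β1 n) 7) :=
  zeroWindow_of_classes (bRay β1 n) (85 * n) (64 * n) p M D S (inPolytope_ray1 n) (inPolytope_shift_ray1 hn) (ray1_zero n)
    (dOf_ray1 n) hp h5 hpn hp2 hM hMe (by omega) hD hlen hC hne

/-- The ORIGIN-regime reduction on ray #1. -/
theorem ray1Origin_of_classes (n p M : ℕ) (D S P : List (List ℤ)) (u : ℤ × ℤ) (c : ℚ) (hn : 1 ≤ n) (hp : p.Prime) (h5 : 5 ≤ p)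
    (hpn : p ≤ 85 * n) (hp2 : 85 * n + 2 < p ^ 2) (hM : 6 ≤ M) (hMe : Even M) (hdeg : (p : ℤ) * ((M : ℤ) - 2) ≤ 128 * n + 1)
    (hu : ¬ ((p : ℤ) ∣ u.1 ∧ (p : ℤ) ∣ u.2)) (hI : LineData u c D S P) (hC : OriginWindowClasses (bRay β1 n) p M D S P)
    (hne : casoratian (bRay β1 n) 7 ≠ 0) : (5 : ℤ) - 2 * M ≤ padicValRat p (casoratian (bRay β1 n) 7) :=
  originWindow_of_classes (bRay β1 n) (85 * n) (64 * n) p M D S P u c (inPolytope_ray1 n) (inPolytope_shift_ray1 hn) (ray1_zero n)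
    (dOf_ray1 n) hp h5 hpn hp2 hM hMe (by omega) hu hI hC hne

/-! ## §2 The window statements, the class-structure nodes and the PROVED reductions -/

/-- **RAY-#1 WINDOW `θ ∈ (20, 21]`** (zero regime, `M = 8`, `casLB + 3`): `v_p(Cas₇(b(n))) ≥ −10 = 6 − 2M`. -/
@[conjecture] def Ray1WindowZ21 : Prop :=
  ∀ n p : ℕ, 2 ≤ n → p.Prime → 20 * n < p → p ≤ 21 * n → casoratian (bRay β1 n) 7 ≠ 0 →
    (-10 : ℤ) ≤ padicValRat p (casoratian (bRay β1 n) 7)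

/-- **CLASS STRUCTURE, ray #1, zero window `(20, 21]`, `M = 8`** (`20n < p ≤ 21n`): the universal `M = 8` zero lists; every window prime with
`n ≤ 200` (2 560 instances), 0 failures (gen-2 g16 `t1rays/wclass.py`, literal evaluation). -/
@[conjecture] def Ray1ZeroClassesZ21 : Prop :=
  ∀ n p : ℕ, 2 ≤ n → p.Prime → 20 * n < p → p ≤ 21 * n → ZeroWindowClasses (bRay β1 n) p 8 ZeroWindows.D8 Sz8

/-- **`Ray1WindowZ21` from its class structure.** -/
theorem ray1WindowZ21_of (hC : Ray1ZeroClassesZ21) : Ray1WindowZ21 := by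
  intro n p hn hp h1 h2 hne
  have h41 : 41 ≤ p := by omega
  have hp2 : 85 * n + 2 < p ^ 2 := by
    have := Nat.mul_le_mul_right p h41
    rw [pow_two]; omega
  exact ray1Zero_of_classes n p 8 ZeroWindows.D8 Sz8 (by omega) hp (by omega) (by omega) hp2 (by norm_num) (by decide)
    (by push_cast; omega) d8_pal d8_sz8_len (hC n p hn hp h1 h2) hne

/-- **RAY-#1 WINDOW `θ ∈ (19, 20]`** (origin regime, `M = 8`, `casLB + 2`): `v_p(Cas₇(b(n))) ≥ −11 = 5 − 2M`. -/
@[conjecture] def Ray1WindowO20 : Prop :=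
  ∀ n p : ℕ, 2 ≤ n → p.Prime → 19 * n < p → p ≤ 20 * n → casoratian (bRay β1 n) 7 ≠ 0 →
    (-11 : ℤ) ≤ padicValRat p (casoratian (bRay β1 n) 7)

/-- **CLASS STRUCTURE, ray #1, origin window `(19, 20]`, `M = 8`** (`19n < p ≤ 20n`): the universal `M = 8` origin lists `Ray4Windows.D8 / S8`
and, for odd `n`, the odd-centre type `Pc8`; every window prime with `n ≤ 200` (2 574 instances), 0 failures. -/
@[conjecture] def Ray1OriginClassesO20 : Prop :=
  ∀ n p : ℕ, 2 ≤ n → p.Prime → 19 * n < p → p ≤ 20 * n →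
    OriginWindowClasses (bRay β1 n) p 8 Ray4Windows.D8 Ray4Windows.S8 Pc8

/-- **`Ray1WindowO20` from its class structure** (the line data being PROVED, `lineData8c`). -/
theorem ray1WindowO20_of (hC : Ray1OriginClassesO20) : Ray1WindowO20 := by
  intro n p hn hp h1 h2 hne
  have h39 : 39 ≤ p := by omega
  have hp2 : 85 * n + 2 < p ^ 2 := by
    have := Nat.mul_le_mul_right p h39
    rw [pow_two]; omega
  exact ray1Origin_of_classes n p 8 Ray4Windows.D8 Ray4Windows.S8 Pc8 Ray4Windows.u8 Ray4Windows.c8 (by omega) hp (by omega) (by omega)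
    hp2 (by norm_num) (by decide) (by push_cast; omega) (Ray4Windows.u8_ne hp) lineData8c (hC n p hn hp h1 h2) hne

/-- Ray #1, `M = 18`: the extra conjugate pair of the zero window `(163/21, 8]` (differs from ray #5's `Sz18`). -/
def S18r1 : List (List ℤ) := [[1, 1, 0, -3, -6, -6, -5, -2, 1, 1, 1]]

/-- **RAY-#1 WINDOW `θ ∈ (38/3, 64/5]`** (zero regime, `M = 12`): `v_p(Cas₇(b(n))) ≥ −18 = 6 − 2M`. -/
@[conjecture] def Ray1WindowZ64o5 : Prop :=
  ∀ n p : ℕ, 2 ≤ n → p.Prime → 38 * n < 3 * p → 5 * p ≤ 64 * n → casoratian (bRay β1 n) 7 ≠ 0 →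
    (-18 : ℤ) ≤ padicValRat p (casoratian (bRay β1 n) 7)

/-- **CLASS STRUCTURE, ray #1, zero window `(38/3, 64/5]`, `M = 12`** (`38n < 3p`, `5p ≤ 64n`): lists `Dz12 / Sz12`; every window prime with
`n ≤ 200` (359 instances), 0 failures. -/
@[conjecture] def Ray1ZeroClassesZ64o5 : Prop :=
  ∀ n p : ℕ, 2 ≤ n → p.Prime → 38 * n < 3 * p → 5 * p ≤ 64 * n → ZeroWindowClasses (bRay β1 n) p 12 Dz12 Sz12

/-- **`Ray1WindowZ64o5` from its class structure.** -/
theorem ray1WindowZ64o5_of (hC : Ray1ZeroClassesZ64o5) : Ray1WindowZ64o5 := by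
  intro n p hn hp h1 h2 hne
  have h26 : 26 ≤ p := by omega
  have hp2 : 85 * n + 2 < p ^ 2 := by
    have := Nat.mul_le_mul_right p h26
    rw [pow_two]; omega
  exact ray1Zero_of_classes n p 12 Dz12 Sz12 (by omega) hp (by omega) (by omega) hp2 (by norm_num) (by decide)
    (by push_cast; omega) (by decide) (by decide) (hC n p hn hp h1 h2) hne

/-- **RAY-#1 WINDOW `θ ∈ (163/21, 8]`** (zero regime, `M = 18`): `v_p(Cas₇(b(n))) ≥ −30 = 6 − 2M`. -/
@[conjecture] def Ray1WindowZ8 : Prop :=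
  ∀ n p : ℕ, 2 ≤ n → p.Prime → 163 * n < 21 * p → p ≤ 8 * n → casoratian (bRay β1 n) 7 ≠ 0 →
    (-30 : ℤ) ≤ padicValRat p (casoratian (bRay β1 n) 7)

/-- **CLASS STRUCTURE, ray #1, zero window `(163/21, 8]`, `M = 18`** (`163n < 21p`, `p ≤ 8n`): lists `Dz18 / S18r1`; every window prime with
`n ≤ 200` (691 instances), 0 failures. -/
@[conjecture] def Ray1ZeroClassesZ8 : Prop :=
  ∀ n p : ℕ, 2 ≤ n → p.Prime → 163 * n < 21 * p → p ≤ 8 * n → ZeroWindowClasses (bRay β1 n) p 18 Dz18 S18r1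

/-- **`Ray1WindowZ8` from its class structure.** -/
theorem ray1WindowZ8_of (hC : Ray1ZeroClassesZ8) : Ray1WindowZ8 := by
  intro n p hn hp h1 h2 hne
  have h16 : 16 ≤ p := by omega
  have hp2 : 85 * n + 2 < p ^ 2 := by
    have := Nat.mul_le_mul_right p h16
    rw [pow_two]; omega
  exact ray1Zero_of_classes n p 18 Dz18 S18r1 (by omega) hp (by omega) (by omega) hp2 (by norm_num) (by decide)
    (by push_cast; omega) (by decide) (by decide) (hC n p hn hp h1 h2) hne

/-! ## §3 Kernel instances at the first window primes, and the unconditional bounds there -/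

/-- Zero window `(20, 21]`, first instance `(n, p) = (2, 41)`. -/
theorem ray1_Z21_2_41 : ZeroWindowClasses (bRay β1 2) 41 8 ZeroWindows.D8 Sz8 := by decide
/-- Zero window `(20, 21]`, `(n, p) = (3, 61)`. -/
theorem ray1_Z21_3_61 : ZeroWindowClasses (bRay β1 3) 61 8 ZeroWindows.D8 Sz8 := by decide
/-- Origin window `(19, 20]`, first instance `(n, p) = (3, 59)` (odd `n`: `b₀ = 255`, the odd-centre type occurs). -/
theorem ray1_O20_3_59 : OriginWindowClasses (bRay β1 3) 59 8 Ray4Windows.D8 Ray4Windows.S8 Pc8 := by decide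
/-- Origin window `(19, 20]`, `(n, p) = (4, 79)` (even `n`). -/
theorem ray1_O20_4_79 : OriginWindowClasses (bRay β1 4) 79 8 Ray4Windows.D8 Ray4Windows.S8 Pc8 := by decide
/-- Zero window `(38/3, 64/5]`, first instance `(n, p) = (7, 89)`. -/
theorem ray1_Z64o5_7_89 : ZeroWindowClasses (bRay β1 7) 89 12 Dz12 Sz12 := by decide
/-- Zero window `(163/21, 8]`, first instance `(n, p) = (6, 47)`. -/
theorem ray1_Z8_6_47 : ZeroWindowClasses (bRay β1 6) 47 18 Dz18 S18r1 := by decide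

/-- **Unconditional**: `v₄₁(Cas₇(b(2))) ≥ −10` on ray #1 (`b(2) = (170; 70,64,60,54,50,44,40)`). -/
theorem ray1_cas_2_41 (hne : casoratian (bRay β1 2) 7 ≠ 0) : (-10 : ℤ) ≤ padicValRat 41 (casoratian (bRay β1 2) 7) :=
  ray1Zero_of_classes 2 41 8 ZeroWindows.D8 Sz8 (by norm_num) (by norm_num) (by norm_num) (by norm_num) (by norm_num) (by norm_num)
    (by decide) (by norm_num) d8_pal d8_sz8_len ray1_Z21_2_41 hne

/-- **Unconditional**: `v₅₉(Cas₇(b(3))) ≥ −11` on ray #1 (origin window, odd centre). -/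
theorem ray1_cas_3_59 (hne : casoratian (bRay β1 3) 7 ≠ 0) : (-11 : ℤ) ≤ padicValRat 59 (casoratian (bRay β1 3) 7) :=
  ray1Origin_of_classes 3 59 8 Ray4Windows.D8 Ray4Windows.S8 Pc8 Ray4Windows.u8 Ray4Windows.c8 (by norm_num) (by norm_num) (by norm_num)
    (by norm_num) (by norm_num) (by norm_num) (by decide) (by norm_num) (Ray4Windows.u8_ne (by norm_num)) lineData8c ray1_O20_3_59 hne

end Summit.KontsevichZagierPeriods.Zeta5Search.T1Rays

end
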